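import Mathlib
import Literature.NumberTheory.Transcendental.ZagierDilogarithmConjecture
import Literature.NumberTheory.Transcendental.PreBlochGroup
import Literature.NumberTheory.Transcendental.PreBlochRelationCriterion
import Literature.NumberTheory.Transcendental.BlochWignerDilogarithm
import Summits.KontsevichZagierPeriods.KontsevichZagierPeriods.Theorems.HyperbolicBlochZagierDilogarithmConjectureStubBorelSlice
import HarnessLib

/-!
# `ZagierDilogarithmConjecture` (stmt-KontsevichZagierPeriods-10550) — line
`kummer-clausen-linearisation` (reshape c2, "Galois descent"), stub `stub_galoisDescent`

**Galois descent for Zagier's dilogarithm conjecture.** Let `zᵢ ∈ ℚ̄ ∩ ℍ⁺`, `nᵢ ∈ ℤ`,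
`β = Σ nᵢ[zᵢ] ∈ ℤ[ℂ]`. Suppose (a) every Dehn invariant `dehn u v β` (tree `Negative/DehnInvariant`: the
anti-symmetrised Bloch symbol paired with two `ℚ`-characters `u, v` of `ℂˣ`) vanishes, and (b) GALOIS
PROPAGATION: for every `ℚ`-algebra map `σ : ℚ̄ → ℂ` (`ℚ̄ = algebraicClosure ℚ ℂ`) and lifts
`wᵢ, w'ᵢ ∈ ℚ̄` of `zᵢ, z̄ᵢ`, the twisted odd volume `Σ nᵢ (D(σwᵢ) − D(σw'ᵢ))` vanishes. Then
`β ∈ ⟨dilogRelators⟩` — GIVEN the printed theorem `Dupont2001_preBloch_relation_of_invariants` (Dupont 2001,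
Thm. 10.24 a) = Borel's regulator theorem 10.18 + Suslin), taken as an explicit hypothesis.

This is the engine behind the Borel slice (lead c1, `stub_borelSlice`, where (b) was DERIVED from "all
points in a number field with one complex place") with the propagation hypothesis made explicit, so that
any combinatorial certificate of propagation (self-similarity `stub_selfSimilar`, e.g. `τ`-symmetric
combinations over biquadratic CM fields `stub_biquadraticSymmetric`) plugs in. At `σ =` the inclusion,
(b) reads `2 Σ nᵢ D(zᵢ) = 0`, so no separate volume hypothesis is needed.

Proof. `ξ := Σ nᵢ([zᵢ] − [z̄ᵢ]) ∈ ℤ⟨ℚ̄ ∖ {0,1}⟩`. (i) Every `ℚ`-character of `ℚ̄ˣ` extends to `ℂˣ`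
(`ℚ` is divisible, hence Baer-injective), and for extended characters the Bloch-symbol pairing of `ξ`
is literally `dehn u v β = 0`. (ii) A ring embedding `σ : ℚ̄ → ℂ` is a `ℚ`-algebra map
(`RingHom.toRatAlgHom`), and the volume of `ξ` at `σ` is the twisted odd volume of (b), hence `0`.
Dupont's theorem puts `ξ` in the five-term span of `ℚ̄`, which pushes forward into `⟨dilogRelators⟩`
(`closure_fiveTerm_le_comap`); adding the conjugation relators `Σ nᵢ([zᵢ] + [z̄ᵢ])` gives `2β`, and
`stub_twoSaturation` halves. Sorry-free; axioms ⊆ {propext, Classical.choice, Quot.sound}; conditional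
only on the named fact, which enters as an explicit hypothesis.
-/

noncomputable section

open scoped BigOperators ComplexConjugate
open Literature.NumberTheory.Transcendental
open FreeAbelianGroup (of lift_apply_of)
open Summit.KontsevichZagierPeriods.HyperbolicBloch.ZagierDilogarithmConjectureNegative
  (ext ext_of_ne sym asym dehn dehn_of)

namespace Summit.KontsevichZagierPeriods.HyperbolicBloch.ZagierDilogarithmGaloisDescent

open Summit.KontsevichZagierPeriods.HyperbolicBloch.ZagierDilogarithm
  (closure_fiveTerm_le_comap stub_twoSaturation)
open Summit.KontsevichZagierPeriods.HyperbolicBloch.ZagierDilogarithmBorelSlice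
  (exists_character_extension ext_eq_of_extension sum_dbl)

/-- **Galois descent** (stub `stub_galoisDescent` of line `kummer-clausen-linearisation`, reshape c2): if
every Dehn invariant of `β = Σ nᵢ[zᵢ]` (algebraic `zᵢ ∈ ℍ⁺`) vanishes and the Galois-twisted odd volumes
`Σ nᵢ (D(σ wᵢ) − D(σ w'ᵢ))` vanish for every `ℚ`-algebra map `σ : ℚ̄ → ℂ` and lifts `wᵢ, w'ᵢ ∈ ℚ̄` of
`zᵢ, z̄ᵢ`, then `β ∈ ⟨dilogRelators⟩`, GIVEN Dupont 2001 Thm. 10.24 a) (Borel's regulator theorem + Suslin).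
[cite: Dupont2001, Thm. 10.24 a)] -/
theorem stub_galoisDescent :
    Dupont2001_preBloch_relation_of_invariants →
    ∀ (k : ℕ) (z : Fin k → ℂ) (n : Fin k → ℤ), (∀ i, IsAlgebraic ℚ (z i)) → (∀ i, 0 < (z i).im) →
      (∀ u v : Additive ℂˣ →+ ℚ, dehn u v (∑ i, n i • FreeAbelianGroup.of (z i)) = 0) →
      (∀ (σ : ↥(algebraicClosure ℚ ℂ) →ₐ[ℚ] ℂ) (w w' : Fin k → ↥(algebraicClosure ℚ ℂ)),
          (∀ i, (w i : ℂ) = z i) → (∀ i, (w' i : ℂ) = conj (z i)) →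
          ∑ i, (n i : ℝ) * (blochWignerDilog (σ (w i)) - blochWignerDilog (σ (w' i))) = 0) →
        (∑ i, n i • FreeAbelianGroup.of (z i)) ∈ AddSubgroup.closure dilogRelators := by
  classical
  intro hD k z n halg him hdehn hprop
  -- the field of algebraic numbers `Q = ℚ̄ ⊂ ℂ`
  set Q : IntermediateField ℚ ℂ := algebraicClosure ℚ ℂ with hQdef
  haveI : IsAlgClosure ℚ Q := algebraicClosure.isAlgClosure ℚ ℂ
  have hQ : ∀ x, x ∈ Q ↔ IsAlgebraic ℚ x := fun _ => mem_algebraicClosure_iff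
  have hKa' : ∀ x, x ∈ Q → IsAlgebraic ℚ x := fun x => (hQ x).1
  -- basic facts on the points
  have hz0 : ∀ i, z i ≠ 0 := fun i h => (him i).ne' (by rw [h]; simp)
  have hz1 : ∀ i, z i ≠ 1 := fun i h => (him i).ne' (by rw [h]; simp)
  have hzc0 : ∀ i, conj (z i) ≠ 0 := fun i => (map_ne_zero _).2 (hz0 i)
  have hzc1 : ∀ i, conj (z i) ≠ 1 := fun i h => hz1 i (by rw [← Complex.conj_conj (z i), h, map_one])
  have halgc : ∀ i, IsAlgebraic ℚ (conj (z i)) := fun i => by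
    simpa using (halg i).algHom (starRingEnd ℂ).toRatAlgHom
  have hzQ : ∀ i, z i ∈ Q := fun i => (hQ _).2 (halg i)
  have hzcQ : ∀ i, conj (z i) ∈ Q := fun i => (hQ _).2 (halgc i)
  -- the doubled configuration `(zᵢ), (z̄ᵢ)` with coefficients `(nᵢ), (−nᵢ)`, in `Q`
  set zz : Fin (k + k) → ℂ := Fin.addCases z (fun i => conj (z i)) with hzzdef
  set m : Fin (k + k) → ℤ := Fin.addCases n (fun i => -n i) with hmdef
  have hzzl : ∀ i, zz (Fin.castAdd k i) = z i := fun i => Fin.addCases_left i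
  have hzzr : ∀ i, zz (Fin.natAdd k i) = conj (z i) := fun i => Fin.addCases_right i
  have hwQ : ∀ j, zz j ∈ Q := by
    intro j
    refine Fin.addCases (fun i => ?_) (fun i => ?_) j
    · rw [hzzl]; exact hzQ i
    · rw [hzzr]; exact hzcQ i
  set w : Fin (k + k) → Q := fun j => ⟨zz j, hwQ j⟩ with hwdef
  have hw0C : ∀ j, zz j ≠ 0 := by
    intro j
    refine Fin.addCases (fun i => ?_) (fun i => ?_) j
    · rw [hzzl]; exact hz0 i
    · rw [hzzr]; exact hzc0 i
  have hw1C : ∀ j, zz j ≠ 1 := by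
    intro j
    refine Fin.addCases (fun i => ?_) (fun i => ?_) j
    · rw [hzzl]; exact hz1 i
    · rw [hzzr]; exact hzc1 i
  have hw : ∀ j, w j ≠ 0 ∧ w j ≠ 1 := fun j =>
    ⟨fun h => hw0C j (congrArg Subtype.val h), fun h => hw1C j (congrArg Subtype.val h)⟩
  -- (i) the symbol condition, from `dehn = 0` by character extension
  have hsymQ : ∀ u' v' : Additive (↥Q)ˣ →+ ℚ,
      ∑ j, (m j : ℚ) * (u' (Additive.ofMul (Units.mk0 (w j) (hw j).1)) *
            v' (Additive.ofMul (Units.mk0 (1 - w j) (sub_ne_zero.2 (hw j).2.symm))) -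
          v' (Additive.ofMul (Units.mk0 (w j) (hw j).1)) *
            u' (Additive.ofMul (Units.mk0 (1 - w j) (sub_ne_zero.2 (hw j).2.symm)))) = 0 := by
    intro u' v'
    obtain ⟨u, hu⟩ := exists_character_extension u'
    obtain ⟨v, hv⟩ := exists_character_extension v'
    have key : ∀ j, (u' (Additive.ofMul (Units.mk0 (w j) (hw j).1)) *
            v' (Additive.ofMul (Units.mk0 (1 - w j) (sub_ne_zero.2 (hw j).2.symm))) -
          v' (Additive.ofMul (Units.mk0 (w j) (hw j).1)) *
            u' (Additive.ofMul (Units.mk0 (1 - w j) (sub_ne_zero.2 (hw j).2.symm)))) =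
        sym u v (zz j) := by
      intro j
      rw [ext_eq_of_extension hu, ext_eq_of_extension hv, ext_eq_of_extension hu,
        ext_eq_of_extension hv]
      simp only [sym, hwdef]
      push_cast
      ring
    simp_rw [key]
    have h0 := hdehn u v
    rw [map_sum] at h0
    simp only [map_zsmul, dehn_of, asym] at h0
    simp only [zsmul_eq_mul] at h0
    rw [show (∑ j, (m j : ℚ) * sym u v (zz j)) =
        ∑ i, (n i : ℚ) * (sym u v (z i) - sym u v (conj (z i))) from ?_]
    · exact h0
    have := sum_dbl z n (fun x => (sym u v x : ℚ))
    simp only [zsmul_eq_mul] at this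
    rw [hmdef, hzzdef, this, ← Finset.sum_sub_distrib]
    refine Finset.sum_congr rfl fun i _ => ?_
    ring
  -- (ii) the volume condition at every embedding of `Q`: the propagation hypothesis at `σ.toRatAlgHom`
  have hvolQ : ∀ σ : Q →+* ℂ, ∑ j, (m j : ℝ) * blochWignerDilog (σ (w j)) = 0 := by
    intro σ
    have hσ := hprop σ.toRatAlgHom (fun i => ⟨z i, hzQ i⟩) (fun i => ⟨conj (z i), hzcQ i⟩)
      (fun i => rfl) (fun i => rfl)
    have := sum_dbl z n (fun x => (if hx : x ∈ Q then blochWignerDilog (σ ⟨x, hx⟩) else 0 : ℝ))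
    simp only [zsmul_eq_mul] at this
    have e1 : ∑ j, (m j : ℝ) * blochWignerDilog (σ (w j)) =
        ∑ j, ((Fin.addCases n (fun i => -n i) : Fin (k + k) → ℤ) j : ℝ) *
          (if hx : (Fin.addCases z (fun i => conj (z i)) : Fin (k + k) → ℂ) j ∈ Q then
            blochWignerDilog (σ ⟨(Fin.addCases z (fun i => conj (z i)) : Fin (k + k) → ℂ) j, hx⟩)
          else 0) := by
      refine Finset.sum_congr rfl fun j _ => ?_
      rw [dif_pos (hwQ j)]
    have e2 : ∑ i, (n i : ℝ) * (if hx : z i ∈ Q then blochWignerDilog (σ ⟨z i, hx⟩) else 0) =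
        ∑ i, (n i : ℝ) * blochWignerDilog (σ.toRatAlgHom ⟨z i, hzQ i⟩) :=
      Finset.sum_congr rfl fun i _ => by rw [dif_pos (hzQ i)]; rfl
    have e3 : ∑ i, (n i : ℝ) * (if hx : conj (z i) ∈ Q then blochWignerDilog (σ ⟨conj (z i), hx⟩)
        else 0) = ∑ i, (n i : ℝ) * blochWignerDilog (σ.toRatAlgHom ⟨conj (z i), hzcQ i⟩) :=
      Finset.sum_congr rfl fun i _ => by rw [dif_pos (hzcQ i)]; rfl
    rw [e1, this, e2, e3, ← Finset.sum_sub_distrib]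
    simpa only [mul_sub] using hσ
  -- Dupont's theorem
  have hmem := hD Q (k + k) w m hw hsymQ hvolQ
  -- push forward to `ℤ[ℂ]`
  let ι : FreeAbelianGroup (PreBloch.Gen Q) →+ FreeAbelianGroup ℂ :=
    FreeAbelianGroup.lift fun g => of (g.val : ℂ)
  have hι : ∀ g, ι (of g) = of (g.val : ℂ) := fun g => lift_apply_of _ _
  have h1 : ι (∑ j, m j • @FreeAbelianGroup.of (PreBloch.Gen Q) ⟨w j, hw j⟩) ∈
      AddSubgroup.closure dilogRelators :=
    closure_fiveTerm_le_comap hKa' ι hι hmem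
  have h2 : ι (∑ j, m j • @FreeAbelianGroup.of (PreBloch.Gen Q) ⟨w j, hw j⟩) =
      ∑ i, n i • of (z i) - ∑ i, n i • of (conj (z i)) := by
    rw [map_sum]
    simp only [map_zsmul, hι]
    rw [hmdef]
    exact sum_dbl z n (fun x => of x)
  rw [h2] at h1
  -- the conjugation relators
  have h3 : ∑ i, n i • of (z i) + ∑ i, n i • of (conj (z i)) ∈ AddSubgroup.closure dilogRelators := by
    rw [← Finset.sum_add_distrib]
    refine AddSubgroup.sum_mem _ fun i _ => ?_
    rw [← zsmul_add]
    exact AddSubgroup.zsmul_mem _ (AddSubgroup.subset_closure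
      (of_add_of_conj_mem_dilogRelators (halg i))) _
  -- halve
  apply stub_twoSaturation
  have h4 := add_mem h1 h3
  rw [sub_add_add_cancel, ← two_nsmul] at h4
  exact h4

end Summit.KontsevichZagierPeriods.HyperbolicBloch.ZagierDilogarithmGaloisDescent

end
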